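import Literature.AnabelianGeometry.EtaleTheta.ThetaKummerInputDeckOfCore
import Literature.AnabelianGeometry.EtaleTheta.SettingModelKummerCocycleP
import HarnessLib

/-!
# Rational exponentials on `Ẑ(1)` and rational powers of the chosen roots `p^{1/N}` (Kummer algebra for the
# «`c·Ü^r·Θ̈^s`» function module at the stage-2 model)

S. Mochizuki, *The étale theta function …*, Publ. RIMS **45** (2009) [EtTh], §1 p. 13 («`K_N := K(ζ_N, q_X^{1/N})`»),
Prop 1.4 (ii) p. 22 («`Θ̈(q_X^{a/2} Ü) = (−1)^a q_X^{−a²/2} Ü^{−2a} Θ̈(Ü)`» — rational powers of `q_X` and roots of unity);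
the Kummer theory is classical (J. Neukirch, *Algebraic Number Theory*, Ch. IV §3) [cite: NeukirchANT1999, Ch. IV §3].

abc-iut cell, layer L2, seat abc-iut-L2-t12 (gen 8), row (β) «NV TWIN of p458029» — part 3a (CONSTRUCTION file, class (b):
two definitions + their laws; no instance, no notation, no `Prop` fact), over abc-iut-L2-t5's `cycGen` / `cycEquiv` /
`pRoots` / `kappaP` (`SettingModelKummerCocycleQ/P`) and abc-iut-w5-d024's `cyclotome.toHom` (`CyclotomeHomQmodZ`):

* `SettingModel.expZH p e : ℚ →* ℚ̄_pˣ` (multiplicative `ℚ`) — the «exponential» `t ↦ exp(2πi·e·t)` attached to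
  `e ∈ Ẑ ≅ Λ(ℚ̄_pˣ)`: `toHom(cycEquiv⁻¹ e) ∘ (ℚ ↠ ℚ/ℤ)`; laws `expZH_mul` (additive in `e`), `expZH_ofAdd`
  (`= ζ_{den}^{num}`), `expZH_ofAdd_inv` (`= (cycEquiv⁻¹ e)_N` at `1/N`), `expZH_ofAdd_intCast` (`= 1` on `ℤ`),
  `expZH_chi` (`G_{ℚ_p}`-equivariance through `χ`), `expZH_zpow`, `expZH_eq_of_level_eq` (depends on `e mod den` only),
  `expZH_half_sq` / `expZH_half_eq_one_or` (value `±1` at `1/2`);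
* `SettingModel.pRatPow p : ℚ →* ℚ̄_pˣ` — «`p^t`» from the CHOSEN compatible roots `pRoots p`:
  `pRatPow (k/N) = (p^{1/N})^k` (`pRatPow_ofAdd_div`), `pRatPow 1 = p` (`pRatPow_ofAdd_one`), and the Galois law
  **`σ • p^t = expZH (κ_p σ) t · p^t`** (`smul_pRatPow`, from abc-iut-L2-t5's `apply_pRoot`).

Used by part 3b (`SettingModelTateThetaFunctionModule`) to write the exponent cocycle of the monomial module at
`ThetaSetting.modelχq p 1 2`. HONEST FRAMING: classical Kummer algebra in `ℚ̄_p`; nothing of [EtTh] is asserted; no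
side is taken on [IUTchIII] Cor 3.12.
-/

noncomputable section

namespace Literature.AnabelianGeometry.EtaleTheta.SettingModel

open Literature.AnabelianGeometry.SemiGraphs

variable (p : ℕ) [Fact p.Prime]

/-! ### `ℚ ↠ ℚ/ℤ` and the exponential attached to `e ∈ Ẑ` -/

/-- `ℚ → ℚ/ℤ`, multiplicatively. [cite: NeukirchANT1999, Ch. IV §3] -/
def ratToCircle : Multiplicative ℚ →* Multiplicative (AddCircle (1 : ℚ)) :=
  AddMonoidHom.toMultiplicative (QuotientAddGroup.mk' (AddSubgroup.zmultiples (1 : ℚ)))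

/-- [cite: NeukirchANT1999, Ch. IV §3] -/
theorem ratToCircle_ofAdd (q : ℚ) :
    ratToCircle (Multiplicative.ofAdd q) = Multiplicative.ofAdd ((q : ℚ) : AddCircle (1 : ℚ)) := rfl

/-- **The exponential `t ↦ “exp(2πi·e·t)”` attached to `e ∈ Ẑ`**: `toHom(cycEquiv⁻¹ e) ∘ (ℚ ↠ ℚ/ℤ) : ℚ → μ_∞(ℚ̄_p)`.
[cite: NeukirchANT1999, Ch. IV §3] -/
def expZH (e : ZH) : Multiplicative ℚ →* (PadicAlgCl p)ˣ := (cyclotome.toHom ((cycEquiv p).symm e)).comp ratToCircle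

/-- [cite: NeukirchANT1999, Ch. IV §3] -/
theorem expZH_ofAdd_eq (e : ZH) (q : ℚ) :
    expZH p e (Multiplicative.ofAdd q) =
      cyclotome.toHom ((cycEquiv p).symm e) (Multiplicative.ofAdd ((q : ℚ) : AddCircle (1 : ℚ))) := rfl

/-- `expZH e (1/N) = (cycEquiv⁻¹ e)_N`. [cite: NeukirchANT1999, Ch. IV §3] -/
theorem expZH_ofAdd_inv (e : ZH) (N : ℕ+) :
    expZH p e (Multiplicative.ofAdd ((1 : ℚ) / (N : ℕ))) = (((cycEquiv p).symm e : cyclotome (PadicAlgCl p)ˣ) :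
      ℕ+ → (PadicAlgCl p)ˣ) N := by
  rw [expZH_ofAdd_eq, cyclotome.toHom_ofAdd_inv]

/-- The denominator of a rational as a positive natural. [cite: NeukirchANT1999, Ch. IV §3] -/
def denP (q : ℚ) : ℕ+ := ⟨q.den, q.den_pos⟩

/-- [cite: NeukirchANT1999, Ch. IV §3] -/
@[simp] theorem coe_denP (q : ℚ) : ((denP q : ℕ+) : ℕ) = q.den := rfl

/-- `q = num q / den q` with the positive-natural denominator. [cite: NeukirchANT1999, Ch. IV §3] -/
theorem eq_num_div_denP (q : ℚ) : q = (q.num : ℚ) / ((denP q : ℕ+) : ℕ) := by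
  rw [coe_denP, Rat.num_div_den]

/-- `expZH e q = ζ_{den q}^{num q}` with `ζ = cycEquiv⁻¹ e`. [cite: NeukirchANT1999, Ch. IV §3] -/
theorem expZH_ofAdd (e : ZH) (q : ℚ) :
    expZH p e (Multiplicative.ofAdd q) = (((cycEquiv p).symm e : cyclotome (PadicAlgCl p)ˣ) :
      ℕ+ → (PadicAlgCl p)ˣ) (denP q) ^ q.num := by
  have hq : Multiplicative.ofAdd q = (Multiplicative.ofAdd ((1 : ℚ) / ((denP q : ℕ+) : ℕ))) ^ q.num := by
    rw [← ofAdd_zsmul, zsmul_eq_mul, mul_one_div, ← eq_num_div_denP]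
  rw [hq, map_zpow, expZH_ofAdd_inv]

/-- Additivity in `e`: `expZH (e·e′) t = expZH e t · expZH e′ t`. [cite: NeukirchANT1999, Ch. IV §3] -/
theorem expZH_mul (e e' : ZH) (t : Multiplicative ℚ) : expZH p (e * e') t = expZH p e t * expZH p e' t := by
  show cyclotome.toHom ((cycEquiv p).symm (e * e')) (ratToCircle t) = _
  rw [map_mul, ← cyclotome.homQmodZEquiv_symm_apply, map_mul, MonoidHom.mul_apply,
    cyclotome.homQmodZEquiv_symm_apply, cyclotome.homQmodZEquiv_symm_apply]
  rfl

/-- `expZH 1 t = 1`. [cite: NeukirchANT1999, Ch. IV §3] -/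
theorem expZH_one (t : Multiplicative ℚ) : expZH p 1 t = 1 := by
  have h := expZH_mul p 1 1 t
  rw [one_mul] at h
  exact mul_eq_left.mp h.symm

/-- `e ↦ expZH e t` as a homomorphism `Ẑ → ℚ̄_pˣ`. [cite: NeukirchANT1999, Ch. IV §3] -/
def expZHAt (t : Multiplicative ℚ) : ZH →* (PadicAlgCl p)ˣ where
  toFun e := expZH p e t
  map_one' := expZH_one p t
  map_mul' e e' := expZH_mul p e e' t

/-- [cite: NeukirchANT1999, Ch. IV §3] -/
theorem expZHAt_apply (t : Multiplicative ℚ) (e : ZH) : expZHAt p t e = expZH p e t := rfl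

/-- `expZH (e^k) t = (expZH e t)^k`. [cite: NeukirchANT1999, Ch. IV §3] -/
theorem expZH_zpow (e : ZH) (k : ℤ) (t : Multiplicative ℚ) : expZH p (e ^ k) t = expZH p e t ^ k := by
  rw [← expZHAt_apply, map_zpow, expZHAt_apply]

/-- `expZH e⁻¹ t = (expZH e t)⁻¹`. [cite: NeukirchANT1999, Ch. IV §3] -/
theorem expZH_inv (e : ZH) (t : Multiplicative ℚ) : expZH p e⁻¹ t = (expZH p e t)⁻¹ := by
  rw [← expZHAt_apply, map_inv, expZHAt_apply]

/-- `expZH e k = 1` for `k ∈ ℤ`. [cite: NeukirchANT1999, Ch. IV §3] -/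
theorem expZH_ofAdd_intCast (e : ZH) (k : ℤ) : expZH p e (Multiplicative.ofAdd (k : ℚ)) = 1 := by
  rw [expZH_ofAdd_eq]
  have hk : (((k : ℚ)) : AddCircle (1 : ℚ)) = 0 := by
    rw [show (k : ℚ) = k • (1 : ℚ) from by rw [zsmul_eq_mul, mul_one], AddCircle.coe_zsmul,
      AddCircle.coe_period, smul_zero]
  rw [hk, ofAdd_zero, map_one]

/-- `expZH e 1 = 1`. [cite: NeukirchANT1999, Ch. IV §3] -/
theorem expZH_ofAdd_one (e : ZH) : expZH p e (Multiplicative.ofAdd (1 : ℚ)) = 1 := by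
  have h := expZH_ofAdd_intCast p e 1
  rwa [Int.cast_one] at h

/-- **`G_{ℚ_p}`-equivariance through the cyclotomic character**: `expZH (χ(σ) e) t = σ • expZH e t`.
[cite: NeukirchANT1999, Ch. IV §3] -/
theorem expZH_chi (σ : GQp p) (e : ZH) (t : Multiplicative ℚ) : expZH p (chi p σ e) t = σ • expZH p e t := by
  have hsymm : (cycEquiv p).symm (chi p σ e) = σ • (cycEquiv p).symm e := by
    apply (cycEquiv p).injective
    rw [MulEquiv.apply_symm_apply, cycEquiv_smul, MulEquiv.apply_symm_apply]
  show cyclotome.toHom ((cycEquiv p).symm (chi p σ e)) (ratToCircle t) = _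
  rw [hsymm, cyclotome.toHom_smul]
  rfl

/-- **`expZH e q` depends on `e` only modulo `den q`.** [cite: NeukirchANT1999, Ch. IV §3] -/
theorem expZH_eq_of_level_eq {e e' : ZH} (q : ℚ) (h : ZHatLevel.level (denP q) e = ZHatLevel.level (denP q) e') :
    expZH p e (Multiplicative.ofAdd q) = expZH p e' (Multiplicative.ofAdd q) := by
  rw [expZH_ofAdd, expZH_ofAdd, ← cycGen_pow_level p ((cycEquiv p).symm e), ← cycGen_pow_level p ((cycEquiv p).symm e'),
    MulEquiv.apply_symm_apply, MulEquiv.apply_symm_apply, h]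

/-- In particular `expZH e q = 1` when `e ≡ 0 (mod den q)`. [cite: NeukirchANT1999, Ch. IV §3] -/
theorem expZH_eq_one_of_level_eq_one {e : ZH} (q : ℚ) (h : ZHatLevel.level (denP q) e = 1) :
    expZH p e (Multiplicative.ofAdd q) = 1 := by
  rw [expZH_eq_of_level_eq p q (e' := 1) (by rw [h, map_one]), expZH_one]

/-- `(expZH e (1/2))² = 1`. [cite: NeukirchANT1999, Ch. IV §3] -/
theorem expZH_half_sq (e : ZH) : expZH p e (Multiplicative.ofAdd ((1 : ℚ) / 2)) ^ 2 = 1 := by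
  rw [← map_pow, ← ofAdd_nsmul, nsmul_eq_mul, Nat.cast_ofNat, mul_one_div_cancel two_ne_zero, expZH_ofAdd_one]

/-- `expZH e (1/2) = ±1`. [cite: NeukirchANT1999, Ch. IV §3] -/
theorem expZH_half_eq_one_or (e : ZH) :
    expZH p e (Multiplicative.ofAdd ((1 : ℚ) / 2)) = 1 ∨ expZH p e (Multiplicative.ofAdd ((1 : ℚ) / 2)) = -1 := by
  have h := expZH_half_sq p e
  have h' : ((expZH p e (Multiplicative.ofAdd ((1 : ℚ) / 2)) : (PadicAlgCl p)ˣ) : PadicAlgCl p) ^ 2 = 1 := by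
    rw [← Units.val_pow_eq_pow_val, h, Units.val_one]
  rcases sq_eq_one_iff.mp h' with h1 | h1
  · exact Or.inl (Units.ext h1)
  · exact Or.inr (Units.ext (by rw [h1, Units.val_neg, Units.val_one]))

/-- `expZH (w²) (q/2) = expZH w q`. [cite: NeukirchANT1999, Ch. IV §3] -/
theorem expZH_sq_half (w : ZH) (q : ℚ) :
    expZH p (w ^ 2) (Multiplicative.ofAdd (q / 2)) = expZH p w (Multiplicative.ofAdd q) := by
  rw [show w ^ 2 = w ^ (2 : ℤ) from (zpow_natCast w 2).symm, expZH_zpow, ← map_zpow, ← ofAdd_zsmul, zsmul_eq_mul,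
    Int.cast_ofNat, mul_div_cancel₀ q two_ne_zero]

/-! ### Rational powers of `p` from the chosen roots `p^{1/N}` -/

/-- The candidate value `p^q := (p^{1/den q})^{num q}`. [cite: NeukirchANT1999, Ch. IV §3] -/
def pRatPowFun (q : ℚ) : (PadicAlgCl p)ˣ := (pRoots p).root (denP q) ^ q.num

/-- `p^{k/N} = (p^{1/N})^k` for EVERY representation `k/N` (compatibility of the chosen roots).
[cite: NeukirchANT1999, Ch. IV §3] -/
theorem pRatPowFun_div (k : ℤ) (N : ℕ+) : pRatPowFun p ((k : ℚ) / (N : ℕ)) = (pRoots p).root N ^ k := by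
  set q : ℚ := (k : ℚ) / (N : ℕ) with hqdef
  have hN : ((N : ℕ) : ℚ) ≠ 0 := Nat.cast_ne_zero.mpr N.ne_zero
  -- `num · N = k · den`
  have hcross : q.num * (N : ℕ) = k * q.den := by
    have h1 : (q.num : ℚ) = q * q.den := (Rat.mul_den_eq_num q).symm
    have h2 : q * (N : ℕ) = k := by rw [hqdef, div_mul_cancel₀ _ hN]
    have h3 : (q.num : ℚ) * (N : ℕ) = k * q.den := by rw [h1, mul_right_comm, h2]
    exact_mod_cast h3
  show (pRoots p).root (denP q) ^ q.num = (pRoots p).root N ^ k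
  have e1 : (pRoots p).root (denP q) = (pRoots p).root (denP q * N) ^ ((N : ℕ) : ℤ) := by
    rw [zpow_natCast, (pRoots p).root_mul_pow]
  have e2 : (pRoots p).root N = (pRoots p).root (N * denP q) ^ ((q.den : ℕ) : ℤ) := by
    rw [zpow_natCast]
    exact ((pRoots p).root_mul_pow N (denP q)).symm
  rw [e1, e2, ← zpow_mul, ← zpow_mul, mul_comm N]
  congr 1
  linarith [hcross]

/-- `p^q = (p^{1/N})^k` whenever `q = k/N`. [cite: NeukirchANT1999, Ch. IV §3] -/
theorem pRatPowFun_eq_of_eq_div {q : ℚ} {k : ℤ} {N : ℕ+} (h : q = (k : ℚ) / (N : ℕ)) :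
    pRatPowFun p q = (pRoots p).root N ^ k := by
  rw [h]; exact pRatPowFun_div p k N

/-- `p^{q + q′} = p^q · p^{q′}`. [cite: NeukirchANT1999, Ch. IV §3] -/
theorem pRatPowFun_add (q q' : ℚ) : pRatPowFun p (q + q') = pRatPowFun p q * pRatPowFun p q' := by
  have h1 : ((q.den : ℕ) : ℚ) ≠ 0 := Nat.cast_ne_zero.mpr q.den_pos.ne'
  have h2 : ((q'.den : ℕ) : ℚ) ≠ 0 := Nat.cast_ne_zero.mpr q'.den_pos.ne'
  have hq : q = ((q.num * q'.den : ℤ) : ℚ) / ((denP q * denP q' : ℕ+) : ℕ) := by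
    rw [PNat.mul_coe, coe_denP, coe_denP]; push_cast
    rw [mul_div_mul_right _ _ h2, Rat.num_div_den]
  have hq' : q' = ((q'.num * q.den : ℤ) : ℚ) / ((denP q * denP q' : ℕ+) : ℕ) := by
    rw [PNat.mul_coe, coe_denP, coe_denP]; push_cast
    rw [mul_comm (q.den : ℚ), mul_div_mul_right _ _ h1, Rat.num_div_den]
  have hsum : q + q' = ((q.num * q'.den + q'.num * q.den : ℤ) : ℚ) / ((denP q * denP q' : ℕ+) : ℕ) := by
    rw [PNat.mul_coe, coe_denP, coe_denP]; push_cast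
    rw [add_div, mul_div_mul_right _ _ h2, mul_comm (q.den : ℚ) (q'.den : ℚ), mul_div_mul_right _ _ h1,
      Rat.num_div_den, Rat.num_div_den]
  rw [pRatPowFun_eq_of_eq_div p hsum, pRatPowFun_eq_of_eq_div p hq, pRatPowFun_eq_of_eq_div p hq', zpow_add]

/-- **`t ↦ p^t : ℚ → ℚ̄_pˣ`** from the chosen compatible roots `pRoots p`. [cite: NeukirchANT1999, Ch. IV §3] -/
def pRatPow : Multiplicative ℚ →* (PadicAlgCl p)ˣ where
  toFun t := pRatPowFun p (Multiplicative.toAdd t)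
  map_one' := by
    show pRatPowFun p (0 : ℚ) = 1
    have h := pRatPowFun_div p 0 1
    rw [Int.cast_zero, zero_div, zpow_zero] at h
    exact h
  map_mul' t t' := pRatPowFun_add p (Multiplicative.toAdd t) (Multiplicative.toAdd t')

/-- [cite: NeukirchANT1999, Ch. IV §3] -/
theorem pRatPow_ofAdd (q : ℚ) : pRatPow p (Multiplicative.ofAdd q) = pRatPowFun p q := rfl

/-- `p^{k/N} = (p^{1/N})^k`. [cite: NeukirchANT1999, Ch. IV §3] -/
theorem pRatPow_ofAdd_div (k : ℤ) (N : ℕ+) :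
    pRatPow p (Multiplicative.ofAdd ((k : ℚ) / (N : ℕ))) = (pRoots p).root N ^ k :=
  pRatPowFun_div p k N

/-- `p^1 = p` (`pUnit p`). [cite: NeukirchANT1999, Ch. IV §3] -/
theorem pRatPow_ofAdd_one : pRatPow p (Multiplicative.ofAdd (1 : ℚ)) = pUnit p := by
  have h := pRatPow_ofAdd_div p 1 1
  rw [Int.cast_one, PNat.one_coe, Nat.cast_one, div_one, zpow_one, (pRoots p).root_one] at h
  exact h

/-- `p^k = (pUnit p)^k` for `k ∈ ℤ`. [cite: NeukirchANT1999, Ch. IV §3] -/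
theorem pRatPow_ofAdd_intCast (k : ℤ) : pRatPow p (Multiplicative.ofAdd (k : ℚ)) = pUnit p ^ k := by
  have h := pRatPow_ofAdd_div p k 1
  rw [PNat.one_coe, Nat.cast_one, div_one, (pRoots p).root_one] at h
  exact h

/-- **The Galois law of the chosen roots, read in `Ẑ`**: `σ • p^{1/N} = expZH (κ_p σ) (1/N) · p^{1/N}`
(abc-iut-L2-t5's `apply_pRoot` + `cycGen_pow_level`). [cite: NeukirchANT1999, Ch. IV §3] -/
theorem smul_pRoots_root (σ : GQp p) (N : ℕ+) :
    σ • (pRoots p).root N = expZH p (kappaP p σ) (Multiplicative.ofAdd ((1 : ℚ) / (N : ℕ))) * (pRoots p).root N := by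
  apply Units.ext
  rw [expZH_ofAdd_inv, ← cycGen_pow_level p ((cycEquiv p).symm (kappaP p σ)) N, MulEquiv.apply_symm_apply,
    Units.val_mul, Units.val_pow_eq_pow_val, coe_pRoots_root, ← apply_pRoot]
  rfl

/-- **`σ • p^t = expZH (κ_p σ) t · p^t`** for all `t ∈ ℚ`. [cite: NeukirchANT1999, Ch. IV §3] -/
theorem smul_pRatPow (σ : GQp p) (t : Multiplicative ℚ) :
    σ • pRatPow p t = expZH p (kappaP p σ) t * pRatPow p t := by
  obtain ⟨k, N, rfl⟩ : ∃ (k : ℤ) (N : ℕ+), t = Multiplicative.ofAdd ((k : ℚ) / (N : ℕ)) :=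
    ⟨(Multiplicative.toAdd t).num, denP (Multiplicative.toAdd t), by rw [← eq_num_div_denP, ofAdd_toAdd]⟩
  rw [pRatPow_ofAdd_div, smul_zpow', smul_pRoots_root, mul_zpow, ← map_zpow, ← ofAdd_zsmul, zsmul_eq_mul,
    mul_one_div]

end Literature.AnabelianGeometry.EtaleTheta.SettingModel

end
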